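/-
Copyright: lit-balaban Phase-2 proof seat p08 (gen 7).  Statement-level skeleton of a published paper; no proof claims beyond what
the kernel checks below.
-/
import Literature.MathematicalPhysics.QuantumFieldTheory.BalabanImbrieJaffe1984to88.BIJ88Eq551Torus
import Literature.MathematicalPhysics.QuantumFieldTheory.BalabanImbrieJaffe1984to88.BIJ88Ineq217SigmaTorus
import Literature.MathematicalPhysics.QuantumFieldTheory.BalabanImbrieJaffe1984to88.BIJ85Sigma422Eta

/-!
# `BalabanImbrieJaffe1984to88.BIJ88Ineq217LandauTorus` — T. Bałaban, J. Imbrie, A. Jaffe, *Effective action and cluster properties of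
the abelian Higgs model*, Commun. Math. Phys. **114** (1988) 257–315 [BalabanImbrieJaffe1988]: **(2.17)** p. 262 ON THE TORUS WITH A
k-UNIFORM NEAR PART — the input *"The near part is similarly bounded since σ_k is a bounded operator on curls [2]"* read THROUGH THE
LANDAU MINIMIZER: by (5.5.1) (`BIJ88Eq551Torus.eq551_torus`, [I] (6.1.5) + (2.15)) `σ_k∂A′ = Q^e_k∂H_kA′`, and `Q^e_k` is an AVERAGE
(`|Q^e_kF| ≤ sup|F|`, (I.2.21)), so on curls σ_k is bounded from the potential `‖A′‖_∞` by the sup-operator norm of `∂H_k` — the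
gradient member of [I] (7.2.2), displayed — with NO factor `η^{−2}`; the near part `∂□A′` of print carries the axial potential `□A′` with
`‖□A′‖_∞ ≤ (d−1)·2R·‖f‖_∞` (gen 6's `abs_axialCopy_le`), whence (2.17) for p30's `sigmaTorus` with a constant independent of `k` at the
printed normalisation `w = η^d`, `c = η⁻¹`, modulo (2.16) and (7.2.2)

statement-level skeleton of published theorems with citation tags; proofs where landed; nothing here is a claim about the Yang–Mills mass gap

PDF held: `paper:balaban1988-cmp114-bij-abelian-higgs-effective-action` (journal page = PDF page + 256), p. 262 [PDF 6]; [2] = [I] =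
[BalabanImbrieJaffe1985] (`paper:balaban1985-cmp97-bij-higgs-minimizers`): (2.21) p. 305, (7.2.1)–(7.2.2) p. 325 [PDF 27] (text layer
re-read this session: *"The kernel H_{k,μν}(x,y) and its gradient decay exponentially … (7.2.2)"*).

CITATION HEADER (lean-in-tree rule).  Part of the lit-balaban TYPED SKELETON (HOME `run/shared/lean/pub/lit-balaban/`), Phase-2 proof
seat p08 (gen 7), unit `lit-balaban-p08`; WHAT IS REPRODUCED = SKELETON row **C2.Eq2.17** (reader file `HOME/lit-balaban-r18/ROWS-C2.md`,
owner r18, referee ref-5), kind «model instance» for the torus σ_k — companion of gen 6's `BIJ88Ineq217Mechanism`/`NearPart`/`Torus`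
(the printed argument) and gen 7's `BIJ88Ineq217SigmaTorus` (the `ℓ²` reading, constant `‖Q^{e*}_k‖² = η^{−2}`); consumer of rows
C2.Eq5.5.1 (`BIJ88Eq551Torus`) and C1.Eq7.2.1-7.2.2 (the displayed `hH`).  TAKING line HOME/STATUS.md (gen 7, sixth target).

THE PRINTED TEXT (p. 262 [PDF 6], verbatim): *"we shall only encounter situations where f^{(k)}(p₂) = (∂A)(p₂) for p₂ near p₁. Then we
prove that (σ_kf^{(k)})(p₁) ≦ ‖f^{(k)}‖_∞ (2.17) as follows. Write f^{(k)} = ∂□A + f′, where □ is the characteristic function of a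
neighborhood of p₂. The distant part (σ_kf′)(p₁) is easily estimated by ‖f^{(k)}‖_∞ by (2.16). The near part is similarly bounded since
σ_k is a bounded operator on curls [2]."*; [I] p. 305: *"(Q^ef)(p′) = L^{−(d−2)} Σ_{p∈B(p′)} f(p). (2.21)"*; [I] p. 325: *"(H_kB)_μ(x) =
Σ_{y∈T₁^{(k)},ν} H_{k,μν}(x; y)B_ν(y). (7.2.1) The kernel H_{k,μν}(x,y) and its gradient decay exponentially. … (7.2.2)"*.

THE TORUS DATA (all in the tree; standing range `k ≤ m + K`, weight `w > 0`, fine curl factor `c ≠ 0`, `2 ≤ d`): `σ_k = sigmaTorus hd w c k`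
(p30), unit plaquette fields `toU f`, unit bond fields `toEj B` (`VecField P k ℝ = PBond P k → ℝ`), the unit curl `curl (c/L^k)` (=
`dOne P k c`, `BIJ85Eq611Torus.dOne_toEj`), the Landau minimizer `H_k = HkE P w c k` (p11), the η-lattice curl `curl c`, the k-fold edge
average `Q^e_k = (torusEdgeCellsTo P 0 k k _ hd).Q` ((I.2.21), p31) = the adjoint of `QesOp` up to `w·η^{−d}` (p30/p33's
`BIJ85Sigma422Eta.adjoint_QesOp_encoded`); gen 6's near part `nearCurl c′ A lo hi = ∂^{c′}(□A′)` on the box of radius `R` about `p₁.src`,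
the kernel `σ(p, q) = (σ_ke_q)(p)` and `applyK`, `supNorm`, `pdist`.

WHAT IS PROVED (0 `sorry`, standard axioms; theorems only — proof lane):
* §1 `curlOp_eq_smul_toP` (the encoding `curlOp w c v = √w·∂^{c}v`), **`sigmaTorus_unitCurl`**: `σ_k(∂^{c/L^k}B) = (w·η^{−d})·Q^e_k(∂^{c}H_kB)`
  for EVERY unit bond field `B` — (5.5.1) on the torus in printed units; `sigmaTorus_unitCurl_eta` (`w = η^d`: factor `1`).
* §2 `abs_cellsQ_le` (an average is bounded by the sup: `|Q F(c)| ≤ D` if `|F| ≤ D`, for any cell geometry with the printed block count),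
  `abs_edgeQ_le` (the k-fold edge average of the tori, block count `(L^k)^{d−2}` = p31's `card_edgeBTo`).
* §3 **`abs_sigmaTorus_unitCurl_le`** — «σ_k is a bounded operator on curls» WITH NO `η^{−2}`: `|(σ_k∂^{c/L^k}B)(p)| ≤ (w·η^{−d})·M_H·‖B‖_∞`
  given the sup-operator bound `hH` of `∂^{c}H_k` (the gradient member of [I] (7.2.2), summed over `y` — displayed).
* §4 the near part: `abs_boxPotential_le` (`‖□A′‖_∞ ≤ (d−1)·2R·‖f‖_∞/|c′|` where `f = ∂^{c′}A` on the box, gen 6's `abs_axialCopy_le`),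
  **`abs_sigmaTorus_nearCurl_le`** (`|(σ_k∂□A′)(p₁)| ≤ (w·η^{−d})·M_H·(d−1)·2R·‖f‖_∞/|c′|`, `c′ = c/L^k`).
* §5 **`abs_ineq217_landau_torus`** — (2.17) ON THE TORUS FOR THE σ_k OF RECORD with the near part through `H_k`:
  `|(σ_kf)(p₁)| ≤ ((w·η^{−d})·M_H·(d−1)·2R/|c/L^k| + c₀S(1 + 8(d−1)R))·‖f‖_∞` given (2.16) at `p₁` beyond `R` (`h216`, row sum `S`) and
  `hH`; **`abs_ineq217_landau_torus_eta`** at the printed normalisation `w = η^d`, `c = η⁻¹ = L^k`: constant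
  `M_H·(d−1)·2R + c₀S(1 + 8(d−1)R)` — INDEPENDENT OF `k` (print's uniform (2.17), modulo the k-uniform inputs (2.16), (7.2.2)).
HONEST SCOPE.  Displayed hypotheses: (2.16) for the kernel of the torus σ_k (row C2.Eq2.16) and the sup-operator form `hH` of the gradient
member of [I] (7.2.2) for the torus `H_k` (row C1.Eq7.2.1-7.2.2; its kernel form + row sums would give `hH` — not done here); the
constant is explicit, not print's `1`; one torus at a time; no `def`, no new named fact; NOT summit progress.  Unit `lit-balaban-p08`
(literature-prover-lit-balaban-p08-g7-0), 2026-08-21.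
-/

open scoped BigOperators RealInnerProductSpace

namespace Literature.MathematicalPhysics.QuantumFieldTheory.BalabanImbrieJaffe1984to88.BIJ88Ineq217LandauTorus

open Balaban1983to89 hiding Site Plaq
open Balaban1983to89.LatticeFieldCalculus Balaban1983to89.T4AxialGaugeSmallField
open BIJ88Sect2Statements BIJ88Close235Proof BIJ88Ineq217Mechanism BIJ88Ineq217NearPart BIJ88Ineq217Torus BIJ88Ineq217SigmaTorus
open BIJ85AxialPropagator411 BIJ85Prop521Torus BIJ85Sigma421Torus BIJ85Eq611Torus BIJ85Prop522Torus BIJ85Sigma422Eta BIJ88Eq551Torus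
open BIJ85CellAverages BIJ85Eq224Base0
-- inside this namespace the bare `Site`/`Plaq` are the `ℤ^d` carriers of the QFT root; the torus ones are renamed:
open Balaban1983to89 renaming Site → TSite, Plaq → TPlaq

noncomputable section

variable {P : Params}

/-! ## §1  (5.5.1) on the torus in printed units: `σ_k(∂B) = (w·η^{−d})·Q^e_k(∂H_kB)` -/

/-- Components are unchanged by p30's `toU`. [folklore] -/
private theorem toU_apply' (k : ℕ) (g : TPlaq P k → ℝ) (p : TPlaq P k) : toU P k g p = g p := rfl

/-- The encoding of p09: `curlOp w c v = √w·∂^{c}v` as an η-plaquette vector (`½‖curlOp w c A‖²` = the exponent of (I.4.1.1)).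
[cite: BalabanImbrieJaffe1985, (4.1.1) p.309] -/
theorem curlOp_eq_smul_toP (w c : ℝ) (v : BondSpace P) :
    curlOp (P := P) w c v = Real.sqrt w • toP P (curl c (WithLp.ofLp v)) := by
  ext p
  rfl

/-- **(5.5.1) ON THE TORUS IN PRINTED UNITS**: for every unit-lattice bond field `B` on `T^{(k)}`,
`σ_k(∂^{c/L^k}B) = (w·η^{−d})·Q^e_k(∂^{c}H_kB)` — `σ_k∂ = Q^e_k∂H_k` (`BIJ88Eq551Torus.eq551_torus_apply`) with the unit curl `dOne = ∂^{c/L^k}`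
(`dOne_toEj`), the encoded η-curl (`curlOp_eq_smul_toP`) and `(Q^{e*}_k)† = (w·η^{−d})·Q^e_k` (`adjoint_QesOp_encoded`, `Q^e_k` = the k-fold
edge average (I.2.21)); `k ≤ m + K`, `w > 0`, `c ≠ 0`, `2 ≤ d`. [cite: BalabanImbrieJaffe1988, (5.5.1) p.283] -/
theorem sigmaTorus_unitCurl (hd : 2 ≤ P.d) {k : ℕ} (hk : k ≤ P.m + P.K) {w : ℝ} (hw : 0 < w) {c : ℝ} (hc : c ≠ 0)
    (B : PBond P k → ℝ) :
    sigmaTorus (P := P) hd w c k (toU P k (curl (c / (P.L : ℝ) ^ k) B)) =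
      (w * ((P.eta k)⁻¹) ^ P.d) •
        toU P k ((torusEdgeCellsTo P 0 k k (Nat.zero_add k) hd).Q
          (curl c (WithLp.ofLp (HkE P w c k (toEj P k B))))) := by
  rw [← dOne_toEj, eq551_torus_apply hd hk hc hw, curlOp_eq_smul_toP, adjoint_QesOp_encoded hd hk hw.le]

/-- The same at the printed weight `w = η^d`: `σ_k(∂^{c/L^k}B) = Q^e_k(∂^{c}H_kB)` exactly. [cite: BalabanImbrieJaffe1988, (5.5.1) p.283] -/
theorem sigmaTorus_unitCurl_eta (hd : 2 ≤ P.d) {k : ℕ} (hk : k ≤ P.m + P.K) {c : ℝ} (hc : c ≠ 0) (B : PBond P k → ℝ) :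
    sigmaTorus (P := P) hd ((P.eta k) ^ P.d) c k (toU P k (curl (c / (P.L : ℝ) ^ k) B)) =
      toU P k ((torusEdgeCellsTo P 0 k k (Nat.zero_add k) hd).Q
        (curl c (WithLp.ofLp (HkE P ((P.eta k) ^ P.d) c k (toEj P k B))))) := by
  rw [sigmaTorus_unitCurl hd hk (pow_pos (eta_pos P k) _) hc, eta_pow_mul_eta_inv_pow, one_smul]

/-! ## §2  An average is bounded by the sup -/

/-- **Averages are bounded by the sup**: for a cell geometry with the printed block count `#B(c) = L^{d−m}` ((I.2.21): `(Qf)(c) =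
L^{−(d−m)}Σ_{p∈B(c)}f(p)`), `|f| ≤ D` implies `|(Qf)(c)| ≤ D`. [cite: BalabanImbrieJaffe1985, (2.21) p.305] -/
theorem abs_cellsQ_le (G : Cells) (hcard : ∀ c : G.C, (G.B c).card = G.L ^ (G.d - G.m)) {F : G.F → ℝ} {D : ℝ}
    (hF : ∀ p, |F p| ≤ D) (c : G.C) : |G.Q F c| ≤ D := by
  unfold Cells.Q
  have hL : (0 : ℝ) < (G.L : ℝ) ^ (G.d - G.m) := pow_pos (by exact_mod_cast G.one_le_L) _
  rw [abs_mul, abs_inv, abs_of_pos hL]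
  have hsum : |∑ p ∈ G.B c, F p| ≤ (G.B c).card * D :=
    (Finset.abs_sum_le_sum_abs _ _).trans ((Finset.sum_le_sum fun p _ => hF p).trans (by simp))
  rw [hcard, Nat.cast_pow] at hsum
  calc ((G.L : ℝ) ^ (G.d - G.m))⁻¹ * |∑ p ∈ G.B c, F p| ≤ ((G.L : ℝ) ^ (G.d - G.m))⁻¹ * ((G.L : ℝ) ^ (G.d - G.m) * D) :=
        mul_le_mul_of_nonneg_left hsum (inv_nonneg.2 hL.le)
    _ = D := by rw [← mul_assoc, inv_mul_cancel₀ hL.ne', one_mul]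

/-- The k-fold edge average `Q^e_k` of the tori (block size `L^k`, `#B^e_k(p′) = (L^k)^{d−2}` — p31's `card_edgeBTo`): `|Q^e_kF| ≤ sup|F|`;
`k ≤ m + K`, `2 ≤ d`. [cite: BalabanImbrieJaffe1985, (2.21) p.305] -/
theorem abs_edgeQ_le (hd : 2 ≤ P.d) {k : ℕ} (hk : k ≤ P.m + P.K) {F : TPlaq P 0 → ℝ} {D : ℝ} (hF : ∀ p, |F p| ≤ D)
    (p' : TPlaq P k) : |(torusEdgeCellsTo P 0 k k (Nat.zero_add k) hd).Q (fun p => F p) p'| ≤ D := by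
  refine abs_cellsQ_le (torusEdgeCellsTo P 0 k k (Nat.zero_add k) hd) (fun c => ?_) hF p'
  rw [show (torusEdgeCellsTo P 0 k k (Nat.zero_add k) hd).L = P.L ^ k from rfl,
    show (torusEdgeCellsTo P 0 k k (Nat.zero_add k) hd).d = P.d from rfl,
    show (torusEdgeCellsTo P 0 k k (Nat.zero_add k) hd).m = 2 from rfl]
  exact card_edgeBTo (P := P) (i := 0) (Nat.zero_add k) hk hd c

/-! ## §3  «σ_k is a bounded operator on curls» through the Landau minimizer -/

/-- **«σ_k is a bounded operator on curls [2]» THROUGH `H_k`, no `η^{−2}`**: given the sup-operator bound of `∂^{c}H_k` (`hH`: the gradient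
member of [I] (7.2.2) summed over the unit-lattice sites — displayed), `|(σ_k∂^{c/L^k}B)(p)| ≤ (w·η^{−d})·M_H·‖B‖_∞` for every unit bond field
`B` and unit plaquette `p`; `k ≤ m + K`, `w > 0`, `c ≠ 0`, `2 ≤ d`. [cite: BalabanImbrieJaffe1988, (2.17) p.262] -/
theorem abs_sigmaTorus_unitCurl_le (hd : 2 ≤ P.d) {k : ℕ} (hk : k ≤ P.m + P.K) {w : ℝ} (hw : 0 < w) {c : ℝ} (hc : c ≠ 0)
    {MH : ℝ} (hH : ∀ (B : PBond P k → ℝ) (p : TPlaq P 0), |curl c (WithLp.ofLp (HkE P w c k (toEj P k B))) p| ≤ MH * supNorm B)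
    (B : PBond P k → ℝ) (p : TPlaq P k) :
    |sigmaTorus (P := P) hd w c k (toU P k (curl (c / (P.L : ℝ) ^ k) B)) p| ≤ w * ((P.eta k)⁻¹) ^ P.d * (MH * supNorm B) := by
  have hwη : 0 ≤ w * ((P.eta k)⁻¹) ^ P.d := (mul_pos hw (pow_pos (inv_pos.2 (eta_pos P k)) _)).le
  rw [sigmaTorus_unitCurl hd hk hw hc B, PiLp.smul_apply, smul_eq_mul, toU_apply', abs_mul, abs_of_nonneg hwη]
  exact mul_le_mul_of_nonneg_left (abs_edgeQ_le hd hk (fun q => hH B q) p) hwη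

/-! ## §4  The near part `∂□A′` of print through its axial potential `□A′` -/

/-- **The axial potential of the near part is small**: with `f = ∂^{c′}A` on the plaquettes of the box of radius `R` about `castSite z₁`
(`2R < sitesPerDir k`, `c′ ≠ 0`), the box-cut axial copy satisfies `|□A′(b)| ≤ (d−1)·2R·‖f‖_∞/|c′|` for EVERY bond `b` (gen 6's
`abs_axialCopy_le` = [T4] axial-gauge smallness, `abs_boxCut_le`, `abs_curl_one_le_of_agree`). [cite: BalabanImbrieJaffe1988, (2.17) p.262] -/
theorem abs_boxPotential_le {k : ℕ} {c' : ℝ} (hc' : c' ≠ 0) {R : ℕ} (hR : 2 * R < P.sitesPerDir k) {z₁ : Fin P.d → ℤ}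
    {f : TPlaq P k → ℝ} {A : VecField P k ℝ} (hf : ∀ p ∈ boxPlaqs (loOf z₁ R) (hiOf z₁ R), f p = curl c' A p) (b : PBond P k) :
    |boxCut (loOf z₁ R) (hiOf z₁ R) (axialCopy A (loOf z₁ R) (hiOf z₁ R)) b| ≤
      ((P.d - 1 : ℕ) : ℝ) * (2 * R : ℕ) * (supNorm f / |c'|) :=
  abs_boxCut_le (by have := supNorm_nonneg f; positivity)
    (fun _ hb => abs_axialCopy_le (div_nonneg (supNorm_nonneg f) (abs_nonneg c'))
      (fun p hp => abs_curl_one_le_of_agree hc' hf hp) (hiOf_le z₁ R) hR hb) b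

/-- Hence `‖□A′‖_∞ ≤ (d−1)·2R·‖f‖_∞/|c′|`. [cite: BalabanImbrieJaffe1988, (2.17) p.262] -/
theorem supNorm_boxPotential_le {k : ℕ} {c' : ℝ} (hc' : c' ≠ 0) {R : ℕ} (hR : 2 * R < P.sitesPerDir k) {z₁ : Fin P.d → ℤ}
    {f : TPlaq P k → ℝ} {A : VecField P k ℝ} (hf : ∀ p ∈ boxPlaqs (loOf z₁ R) (hiOf z₁ R), f p = curl c' A p) :
    supNorm (boxCut (loOf z₁ R) (hiOf z₁ R) (axialCopy A (loOf z₁ R) (hiOf z₁ R))) ≤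
      ((P.d - 1 : ℕ) : ℝ) * (2 * R : ℕ) * (supNorm f / |c'|) :=
  supNorm_le (by have := supNorm_nonneg f; positivity) (abs_boxPotential_le hc' hR hf)

/-- **The near part bounded through `H_k`**: for the near part `∂^{c′}□A′` of print (`nearCurl c′ A lo hi`, `c′ = c/L^k` the unit curl
factor of the torus σ_k), `|(σ_k ∂^{c′}□A′)(p₁)| ≤ (w·η^{−d})·M_H·(d−1)·2R·‖f‖_∞/|c′|` — §3 applied to the potential `□A′` and §4's bound on
it; no factor `η^{−2}`. [cite: BalabanImbrieJaffe1988, (2.17) p.262] -/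
theorem abs_sigmaTorus_nearCurl_le (hd : 2 ≤ P.d) {k : ℕ} (hk : k ≤ P.m + P.K) {w : ℝ} (hw : 0 < w) {c : ℝ} (hc : c ≠ 0)
    {MH : ℝ} (hMH : 0 ≤ MH)
    (hH : ∀ (B : PBond P k → ℝ) (p : TPlaq P 0), |curl c (WithLp.ofLp (HkE P w c k (toEj P k B))) p| ≤ MH * supNorm B)
    {R : ℕ} (hR : 2 * R < P.sitesPerDir k) {z₁ : Fin P.d → ℤ} {f : TPlaq P k → ℝ} {A : VecField P k ℝ}
    (hf : ∀ p ∈ boxPlaqs (loOf z₁ R) (hiOf z₁ R), f p = curl (c / (P.L : ℝ) ^ k) A p) (p₁ : TPlaq P k) :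
    |sigmaTorus (P := P) hd w c k (toU P k (nearCurl (c / (P.L : ℝ) ^ k) A (loOf z₁ R) (hiOf z₁ R))) p₁| ≤
      w * ((P.eta k)⁻¹) ^ P.d * (MH * (((P.d - 1 : ℕ) : ℝ) * (2 * R : ℕ) * (supNorm f / |c / (P.L : ℝ) ^ k|))) := by
  have hc' : c / (P.L : ℝ) ^ k ≠ 0 := div_ne_zero hc (pow_ne_zero _ (Nat.cast_ne_zero.2 P.L_pos.ne'))
  have hwη : 0 ≤ w * ((P.eta k)⁻¹) ^ P.d := (mul_pos hw (pow_pos (inv_pos.2 (eta_pos P k)) _)).le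
  refine (abs_sigmaTorus_unitCurl_le hd hk hw hc hH _ p₁).trans ?_
  exact mul_le_mul_of_nonneg_left (mul_le_mul_of_nonneg_left (supNorm_boxPotential_le hc' hR hf) hMH) hwη

/-! ## §5  (2.17) on the torus, near part through `H_k` -/

/-- **(2.17) ON THE TORUS FOR THE σ_k OF RECORD, NEAR PART THROUGH THE LANDAU MINIMIZER** p. 262: for p30's `σ_k = sigmaTorus hd w c k`, a
unit plaquette field `f` with `f = ∂^{c/L^k}A` on the plaquettes of the box of radius `R` about `p₁.src = castSite z₁` (print's *"f^{(k)}(p₂) =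
(∂A)(p₂) for p₂ near p₁"*; `2R < sitesPerDir k`), (2.16) for the kernel `σ(p₁, p₂) = (σ_ke_{p₂})(p₁)` beyond `R` with row sum `S` (`h216`,
`hS`), and the sup-operator bound `hH` of `∂^{c}H_k` ([I] (7.2.2), gradient member): `|(σ_kf)(p₁)| ≤ ((w·η^{−d})·M_H·(d−1)·2R/|c/L^k| +
c₀S(1 + 8(d−1)R))·‖f‖_∞` — the split `f = ∂□A′ + f′` of print (gen 6's `abs_applyK_split_le`, `nearCurl_agree_of_pdist_lt`,
`supNorm_nearCurl_le_centred`) with the near part bounded by `abs_sigmaTorus_nearCurl_le`; `k ≤ m + K`, `w > 0`, `c ≠ 0`, `2 ≤ d`.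
[cite: BalabanImbrieJaffe1988, (2.17) p.262] -/
theorem abs_ineq217_landau_torus (hd : 2 ≤ P.d) {k : ℕ} (hk : k ≤ P.m + P.K) {w : ℝ} (hw : 0 < w) {c : ℝ} (hc : c ≠ 0)
    {MH c₀ δ S : ℝ} (hMH : 0 ≤ MH) (hc₀ : 0 ≤ c₀)
    (hH : ∀ (B : PBond P k → ℝ) (p : TPlaq P 0), |curl c (WithLp.ofLp (HkE P w c k (toEj P k B))) p| ≤ MH * supNorm B)
    {R : ℕ} (hR : 2 * R < P.sitesPerDir k) {p₁ : TPlaq P k} {z₁ : Fin P.d → ℤ} (h₁ : p₁.src = castSite z₁)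
    (h216 : ∀ p₂, (R : ℝ) ≤ pdist p₁ p₂ →
      |sigmaTorus (P := P) hd w c k (toU P k (Pi.single p₂ 1)) p₁| ≤ c₀ * Real.exp (-δ * pdist p₁ p₂))
    (hS : ∑ p₂, Real.exp (-δ * pdist p₁ p₂) ≤ S)
    {f : TPlaq P k → ℝ} {A : VecField P k ℝ} (hf : ∀ p ∈ boxPlaqs (loOf z₁ R) (hiOf z₁ R), f p = curl (c / (P.L : ℝ) ^ k) A p) :
    |sigmaTorus (P := P) hd w c k (toU P k f) p₁| ≤
      (w * ((P.eta k)⁻¹) ^ P.d * MH * (((P.d - 1 : ℕ) : ℝ) * (2 * R : ℕ)) / |c / (P.L : ℝ) ^ k| +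
        c₀ * S * (1 + 8 * ((P.d - 1 : ℕ) : ℝ) * R)) * supNorm f := by
  have hc' : c / (P.L : ℝ) ^ k ≠ 0 := div_ne_zero hc (pow_ne_zero _ (Nat.cast_ne_zero.2 P.L_pos.ne'))
  set g := nearCurl (c / (P.L : ℝ) ^ k) A (loOf z₁ R) (hiOf z₁ R) with hg
  -- the near bound, read for the kernel
  have hnear : |applyK (fun p q => sigmaTorus (P := P) hd w c k (toU P k (Pi.single q 1)) p) g p₁| ≤
      w * ((P.eta k)⁻¹) ^ P.d * (MH * (((P.d - 1 : ℕ) : ℝ) * (2 * R : ℕ) * (supNorm f / |c / (P.L : ℝ) ^ k|))) := by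
    rw [applyK_sigmaKernel]
    exact abs_sigmaTorus_nearCurl_le hd hk hw hc hMH hH hR hf p₁
  have hsplit := abs_applyK_split_le (σ := fun p q => sigmaTorus (P := P) hd w c k (toU P k (Pi.single q 1)) p) hc₀ h216 hS
    hnear (nearCurl_agree_of_pdist_lt h₁ hf)
  rw [applyK_sigmaKernel] at hsplit
  have hgK : supNorm g ≤ (8 * ((P.d - 1 : ℕ) : ℝ) * R) * supNorm f := supNorm_nearCurl_le_centred hc' hR hf
  have hS0 : 0 ≤ S := le_trans (Finset.sum_nonneg fun _ _ => (Real.exp_pos _).le) hS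
  have hfN := supNorm_nonneg f
  calc |sigmaTorus (P := P) hd w c k (toU P k f) p₁|
      ≤ w * ((P.eta k)⁻¹) ^ P.d * (MH * (((P.d - 1 : ℕ) : ℝ) * (2 * R : ℕ) * (supNorm f / |c / (P.L : ℝ) ^ k|))) +
          c₀ * S * (supNorm f + supNorm g) := hsplit
    _ ≤ w * ((P.eta k)⁻¹) ^ P.d * (MH * (((P.d - 1 : ℕ) : ℝ) * (2 * R : ℕ) * (supNorm f / |c / (P.L : ℝ) ^ k|))) +
          c₀ * S * (supNorm f + (8 * ((P.d - 1 : ℕ) : ℝ) * R) * supNorm f) :=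
        add_le_add le_rfl (mul_le_mul_of_nonneg_left (add_le_add le_rfl hgK) (mul_nonneg hc₀ hS0))
    _ = (w * ((P.eta k)⁻¹) ^ P.d * MH * (((P.d - 1 : ℕ) : ℝ) * (2 * R : ℕ)) / |c / (P.L : ℝ) ^ k| +
          c₀ * S * (1 + 8 * ((P.d - 1 : ℕ) : ℝ) * R)) * supNorm f := by ring

/-- **(2.17) ON THE TORUS AT THE PRINTED NORMALISATION, k-UNIFORM CONSTANT**: at `w = η^d` and fine curl factor `c = η⁻¹ = L^k` (so the
unit curl is `∂¹`), `|(σ_kf)(p₁)| ≤ (M_H·(d−1)·2R + c₀S(1 + 8(d−1)R))·‖f‖_∞` — no `η` left: print's k-uniform (2.17), modulo the k-uniform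
inputs (2.16) (`h216`, `hS`) and the gradient member of [I] (7.2.2) (`hH`). [cite: BalabanImbrieJaffe1988, (2.17) p.262] -/
theorem abs_ineq217_landau_torus_eta (hd : 2 ≤ P.d) {k : ℕ} (hk : k ≤ P.m + P.K) {MH c₀ δ S : ℝ} (hMH : 0 ≤ MH) (hc₀ : 0 ≤ c₀)
    (hH : ∀ (B : PBond P k → ℝ) (p : TPlaq P 0),
      |curl ((P.L : ℝ) ^ k) (WithLp.ofLp (HkE P ((P.eta k) ^ P.d) ((P.L : ℝ) ^ k) k (toEj P k B))) p| ≤ MH * supNorm B)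
    {R : ℕ} (hR : 2 * R < P.sitesPerDir k) {p₁ : TPlaq P k} {z₁ : Fin P.d → ℤ} (h₁ : p₁.src = castSite z₁)
    (h216 : ∀ p₂, (R : ℝ) ≤ pdist p₁ p₂ →
      |sigmaTorus (P := P) hd ((P.eta k) ^ P.d) ((P.L : ℝ) ^ k) k (toU P k (Pi.single p₂ 1)) p₁| ≤ c₀ * Real.exp (-δ * pdist p₁ p₂))
    (hS : ∑ p₂, Real.exp (-δ * pdist p₁ p₂) ≤ S)
    {f : TPlaq P k → ℝ} {A : VecField P k ℝ} (hf : ∀ p ∈ boxPlaqs (loOf z₁ R) (hiOf z₁ R), f p = curl 1 A p) :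
    |sigmaTorus (P := P) hd ((P.eta k) ^ P.d) ((P.L : ℝ) ^ k) k (toU P k f) p₁| ≤
      (MH * (((P.d - 1 : ℕ) : ℝ) * (2 * R : ℕ)) + c₀ * S * (1 + 8 * ((P.d - 1 : ℕ) : ℝ) * R)) * supNorm f := by
  have hL : ((P.L : ℝ) ^ k) ≠ 0 := pow_ne_zero _ (Nat.cast_ne_zero.2 P.L_pos.ne')
  have hone : (P.L : ℝ) ^ k / (P.L : ℝ) ^ k = 1 := div_self hL
  have hf' : ∀ p ∈ boxPlaqs (loOf z₁ R) (hiOf z₁ R), f p = curl ((P.L : ℝ) ^ k / (P.L : ℝ) ^ k) A p := by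
    rw [hone]; exact hf
  have h := abs_ineq217_landau_torus hd hk (pow_pos (eta_pos P k) _) hL hMH hc₀ hH hR h₁ h216 hS hf'
  rw [hone, abs_one, div_one, eta_pow_mul_eta_inv_pow, one_mul] at h
  exact h

end

end Literature.MathematicalPhysics.QuantumFieldTheory.BalabanImbrieJaffe1984to88.BIJ88Ineq217LandauTorus
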